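import Literature.RepresentationTheory.HarrisKudlaSweet1996.UnitarySeesaw
import Literature.NumberTheory.Weil1964.ThetaSeriesProduct
import HarnessLib

/-!
# Theta kernels of a unitary seesaw `W = W₁ ⊕ W₂` multiply on pure tensors — proved from Weil's theta-series formula
# (1964, n° 41), MVW's tensor decomposition of `ω_ψ` along `j̃` (Chap. 2 II.1 Rem. (6)) and the compatibility of the
# splittings (HKS 1996 Cor. A.3 + partner side)

This module joins `Literature/RepresentationTheory/HarrisKudlaSweet1996/UnitarySeesaw.lean` (the Weil representations
of the unitary pairs `G(Wⱼ) × H(V)`, `G(W) × H(V)` as PULLBACKS `omega`, `omega₁`, `omega₂` of `ω_ψ` along the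
splittings [GanTakeda2015, §2.8]; `SplittingsCompatible`) with `Literature/NumberTheory/Weil1964/ThetaSeriesProduct.lean`
(Weil's formula `Θ(S) = Σ_{ξ ∈ X_k} (SΦ)(ξ)` [Weil1964, n° 41, Thm 6 p. 193] as `ThetaSeriesDatum.thetaSeries`, and
`thetaSeries_pair`).  For `𝕎 = Res(W ⊗ V) = 𝕎₁ ⊕ 𝕎₂`, `X_k = X_{1,k} × X_{2,k}`, pure tensors `e(φ₁ ⊗ φ₂)` evaluating
as products on rational points, `ω_ψ ∘ j̃ ≃ ω_ψ^1 ⊠ ω_ψ^2` through `e` [MoeglinVignerasWaldspurger1987, II.1 Rem. (6)]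
and compatible splittings, it is PROVED that the theta KERNELS of the three unitary pairs multiply:
`θ_{e(φ₁⊗φ₂)}((g₁,g₂), h) = θ_{φ₁}(g₁, h) · θ_{φ₂}(g₂, h)` (under absolute convergence of the two factor series) —
`UnitarySeesawCover.thetaKernel_pair`.  Every ingredient is an explicit hypothesis on bare carriers; nothing is asserted.

NOT here: convergence, adelic points, automorphy of the kernels, any particular dual pair.

## References

* [Weil1964] A. Weil, Acta Math. 111 (1964), n° 41 Thm 6 p. 193 (the formula for `Θ`).
* [MoeglinVignerasWaldspurger1987] MVW, LNM 1291, Chap. 2 II.1 Rem. (6).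
* [HarrisKudlaSweet1996] HKS, JAMS 9 (1996), Cor. A.3 p. 998; [GanTakeda2015] §2.8.
-/

namespace Literature.RepresentationTheory.HarrisKudlaSweet1996

open scoped TensorProduct
open Literature.NumberTheory.Weil1964

namespace UnitarySeesawCover

universe uM uS uX

variable {G₁ G₂ G H : Type*} {M₁ M₂ M : Type uM} {S₁ S₂ S : Type uS} [Group M₁] [Group M₂] [Group M]
  [AddCommGroup S₁] [Module ℂ S₁] [AddCommGroup S₂] [Module ℂ S₂] [AddCommGroup S] [Module ℂ S]
  {Xk₁ Xk₂ : Type uX}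

/-- The theta-series datum of the cover `Mp(𝕎ⱼ)` acting on `Sⱼ` by `ω_ψ^j`, with a given evaluation of `Sⱼ` on the
rational points `X_{j,k}` ([Weil1964, n° 41]: `Θ(S) = Σ_{ξ ∈ X_k} (SΦ)(ξ)`). [cite: Weil1964, Chap. III n° 41, Thm 6 p. 193] -/
def thetaDatum₁ (C : UnitarySeesawCover G₁ G₂ G H M₁ M₂ M S₁ S₂ S) (ev₁ : S₁ → Xk₁ → ℂ) :
    ThetaSeriesDatum M₁ S₁ Xk₁ where
  act m x := C.Ω₁ m x
  ev := ev₁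

/-- As `thetaDatum₁`, for `Mp(𝕎₂)` on `S₂`. [cite: Weil1964, Chap. III n° 41, Thm 6 p. 193] -/
def thetaDatum₂ (C : UnitarySeesawCover G₁ G₂ G H M₁ M₂ M S₁ S₂ S) (ev₂ : S₂ → Xk₂ → ℂ) :
    ThetaSeriesDatum M₂ S₂ Xk₂ where
  act m x := C.Ω₂ m x
  ev := ev₂

/-- As `thetaDatum₁`, for `Mp(𝕎)` on `S`, `X_k = X_{1,k} × X_{2,k}`. [cite: Weil1964, Chap. III n° 41, Thm 6 p. 193] -/
def thetaDatum (C : UnitarySeesawCover G₁ G₂ G H M₁ M₂ M S₁ S₂ S) (ev : S → Xk₁ × Xk₂ → ℂ) :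
    ThetaSeriesDatum M S (Xk₁ × Xk₂) where
  act m x := C.Ω m x
  ev := ev

/-- The theta KERNEL of the unitary pair `G(W₁) × H(V)`: `θ_{φ₁}(g₁, h) := Θ_{φ₁}(ι̃_{V,χ_V}(g₁) · ι̃_{W₁,χ₁}(h))`,
Weil's theta series of `φ₁` at the image of `(g₁, h)` in `Mp(𝕎₁)` (pullback, [GanTakeda2015, §2.8]). [folklore] -/
noncomputable def thetaKernel₁ (C : UnitarySeesawCover G₁ G₂ G H M₁ M₂ M S₁ S₂ S) (ev₁ : S₁ → Xk₁ → ℂ) (φ₁ : S₁)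
    (g₁ : G₁) (h : H) : ℂ :=
  (C.thetaDatum₁ ev₁).thetaSeries φ₁ (C.ιW₁ g₁ * C.ιV₁ h)

/-- The theta kernel of `G(W₂) × H(V)`: `θ_{φ₂}(g₂, h) := Θ_{φ₂}(ι̃_{V,χ_V}(g₂) · ι̃_{W₂,χ₂}(h))`. [folklore] -/
noncomputable def thetaKernel₂ (C : UnitarySeesawCover G₁ G₂ G H M₁ M₂ M S₁ S₂ S) (ev₂ : S₂ → Xk₂ → ℂ) (φ₂ : S₂)
    (g₂ : G₂) (h : H) : ℂ :=
  (C.thetaDatum₂ ev₂).thetaSeries φ₂ (C.ιW₂ g₂ * C.ιV₂ h)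

/-- The theta kernel of `G(W) × H(V)` restricted to `G(W₁) × G(W₂) × H(V)`:
`θ_{Φ}((g₁,g₂), h) := Θ_{Φ}(ι̃_{V,χ_V}(g₁,g₂) · ι̃_{W,χ_W}(h))`. [folklore] -/
noncomputable def thetaKernel (C : UnitarySeesawCover G₁ G₂ G H M₁ M₂ M S₁ S₂ S) (ev : S → Xk₁ × Xk₂ → ℂ) (Φ : S)
    (g₁ : G₁) (g₂ : G₂) (h : H) : ℂ :=
  (C.thetaDatum ev).thetaSeries Φ (C.ιW (C.incl g₁ g₂) * C.ιV h)

/-- **Theta kernels of pure tensors multiply on the seesaw.**  Hypotheses: `e : S₁ ⊗ S₂ ≃ S` identifies pure tensors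
with products on rational points (`hev` : `e(x₁ ⊗ x₂)(ξ₁, ξ₂) = x₁(ξ₁) x₂(ξ₂)`), intertwines `ω_ψ^1 ⊠ ω_ψ^2` with
`ω_ψ ∘ j̃` (`hKu`, [MoeglinVignerasWaldspurger1987, II.1 Rem. (6)]), the splittings are compatible on
`G(W₁) × G(W₂) × H(V)` (`hcompat`; from HKS Cor. A.3 + the partner side, `splittingsCompatible_of`), and the two
factor series converge absolutely.  Then `θ_{e(φ₁⊗φ₂)}((g₁,g₂), h) = θ_{φ₁}(g₁, h) · θ_{φ₂}(g₂, h)`. [folklore] -/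
theorem thetaKernel_pair (C : UnitarySeesawCover G₁ G₂ G H M₁ M₂ M S₁ S₂ S) (ev₁ : S₁ → Xk₁ → ℂ)
    (ev₂ : S₂ → Xk₂ → ℂ) (ev : S → Xk₁ × Xk₂ → ℂ) (e : S₁ ⊗[ℂ] S₂ ≃ₗ[ℂ] S)
    (hev : ∀ (x₁ : S₁) (x₂ : S₂) (ξ : Xk₁ × Xk₂), ev (e (x₁ ⊗ₜ[ℂ] x₂)) ξ = ev₁ x₁ ξ.1 * ev₂ x₂ ξ.2)
    (hKu : ∀ (m₁ : M₁) (m₂ : M₂) (x₁ : S₁) (x₂ : S₂),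
      e (C.Ω₁ m₁ x₁ ⊗ₜ[ℂ] C.Ω₂ m₂ x₂) = C.Ω (C.jt (m₁, m₂)) (e (x₁ ⊗ₜ[ℂ] x₂)))
    (hcompat : C.SplittingsCompatible) {φ₁ : S₁} {φ₂ : S₂} {g₁ : G₁} {g₂ : G₂} {h : H}
    (h₁ : (C.thetaDatum₁ ev₁).AbsSummableAt φ₁ (C.ιW₁ g₁ * C.ιV₁ h))
    (h₂ : (C.thetaDatum₂ ev₂).AbsSummableAt φ₂ (C.ιW₂ g₂ * C.ιV₂ h)) :
    C.thetaKernel ev (e (φ₁ ⊗ₜ[ℂ] φ₂)) g₁ g₂ h = C.thetaKernel₁ ev₁ φ₁ g₁ h * C.thetaKernel₂ ev₂ φ₂ g₂ h := by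
  unfold thetaKernel thetaKernel₁ thetaKernel₂
  rw [← hcompat g₁ g₂ h]
  refine (C.thetaDatum₁ ev₁).thetaSeries_pair (C.thetaDatum₂ ev₂) (C.thetaDatum ev) (fun x₁ x₂ => e (x₁ ⊗ₜ[ℂ] x₂))
    (fun m₁ m₂ => C.jt (m₁, m₂)) hev ?_ h₁ h₂
  -- `ω_ψ(j̃(m₁,m₂)) (e (φ₁ ⊗ φ₂)) = e (ω_ψ^1(m₁)φ₁ ⊗ ω_ψ^2(m₂)φ₂)`
  exact (hKu _ _ φ₁ φ₂).symm

/-- The same with the product `H`-side/`G`-side hypotheses of `UnitarySeesaw.lean` in place of `hcompat`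
(HKS Cor. A.3 for the `G`-side splittings + `HSideCompatible`). [folklore] -/
theorem thetaKernel_pair_of_compatible (C : UnitarySeesawCover G₁ G₂ G H M₁ M₂ M S₁ S₂ S) (ev₁ : S₁ → Xk₁ → ℂ)
    (ev₂ : S₂ → Xk₂ → ℂ) (ev : S → Xk₁ × Xk₂ → ℂ) (e : S₁ ⊗[ℂ] S₂ ≃ₗ[ℂ] S)
    (hev : ∀ (x₁ : S₁) (x₂ : S₂) (ξ : Xk₁ × Xk₂), ev (e (x₁ ⊗ₜ[ℂ] x₂)) ξ = ev₁ x₁ ξ.1 * ev₂ x₂ ξ.2)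
    (hKu : ∀ (m₁ : M₁) (m₂ : M₂) (x₁ : S₁) (x₂ : S₂),
      e (C.Ω₁ m₁ x₁ ⊗ₜ[ℂ] C.Ω₂ m₂ x₂) = C.Ω (C.jt (m₁, m₂)) (e (x₁ ⊗ₜ[ℂ] x₂)))
    (hA3 : C.toHKSRestrictionDatum.SplittingRestricts) (hH : C.HSideCompatible)
    {φ₁ : S₁} {φ₂ : S₂} {g₁ : G₁} {g₂ : G₂} {h : H}
    (h₁ : (C.thetaDatum₁ ev₁).AbsSummableAt φ₁ (C.ιW₁ g₁ * C.ιV₁ h))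
    (h₂ : (C.thetaDatum₂ ev₂).AbsSummableAt φ₂ (C.ιW₂ g₂ * C.ιV₂ h)) :
    C.thetaKernel ev (e (φ₁ ⊗ₜ[ℂ] φ₂)) g₁ g₂ h = C.thetaKernel₁ ev₁ φ₁ g₁ h * C.thetaKernel₂ ev₂ φ₂ g₂ h :=
  C.thetaKernel_pair ev₁ ev₂ ev e hev hKu (splittingsCompatible_of hA3 hH) h₁ h₂

end UnitarySeesawCover

end Literature.RepresentationTheory.HarrisKudlaSweet1996
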